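import Literature.Topology.FourManifolds.SaddleLevelCircle
import HarnessLib

/-!
# On an oriented closed surface the level above the lowest saddle is disconnected

Topic `Literature/Topology/FourManifolds` (the orientation half of the dimension-`2` leaf of
`Literature.Topology.FourManifolds.HomotopySphere.contractibleSpace_compl_image_ball`; consumed by
`HomotopyTwoSphereNoSaddle.lean`).  Everything here is **proved**.

**Theorem** (`LowestSaddle.exists_level_split`).  In the setting of `SaddleLevelCircle.lean`
(`LowestSaddle`: Morse `f` on a closed surface `M`, smooth gradient-like `ξ`, lowest saddle `s`
with value `c`, alone on its level, only the minimum below it), if `M` carries a smooth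
orientation then the level `f⁻¹(c + δ)` just above the saddle is the disjoint union of two
nonempty closed sets.

This is the smooth-category form of the remark that *on an orientable surface every `1`-handle
is attached untwisted, so passing the lowest saddle splits the level circle into two circles*
(Matsumoto, *An Introduction to Morse Theory* (2001), §1.5(b) (PDF pp. 48–49), Fig. 1.15–1.17; Hirsch,
*Differential Topology* (1976), Ch. 9 §3, the classification of surfaces through Morse functions),
proved here without handles:

1. (`SaddleLevelCircle.lean`) the level `L'' = f⁻¹(c - κ)` below the saddle is a smooth circle
   `h`, with nowhere degenerate moving frame `(ξ ∘ h, ḣ)`, passing the stable manifold of `s` at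
   `e± = φ⁻¹(±√κ, 0)` with vertical chart velocity `(0, b±)`.
2. (**Orientation**, `OrientationChartSign.lean`) the orientation character of the moving frame
   is constant along `h`; reading it in the Milnor chart of `s` at `e₊` and `e₋` (the chart has
   constant character on its connected box) gives `det((-√κ,0),(0,b₊))` and `det((√κ,0),(0,b₋))`
   the same sign: **`b₊ b₋ < 0`**.  Hence the arc of `L''` from `e₊` to `e₋` leaves `e₊` and
   reaches `e₋` on the *same* side `{sign y = σ}` of the stable manifold — the handle is
   untwisted.
3. (`MilnorBoxSurface.lean`, Milnor's hyperbolas `x y = const`) flowing up to the level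
   `L = f⁻¹(c + δ)`, points of `L''` near `e±` on the side `sign y = σ` arrive near
   `d_σ = φ⁻¹(0, σ√δ)`; so the image of that arc, closed up by the single point `d_σ`, is a
   closed subset `K` of `L`, the other arc gives `K' ∋ d_{-σ}`, and `L = K ⊔ K'`.

## References

* Y. Matsumoto, *An Introduction to Morse Theory*, AMS (2001), §1.5(b), PDF pp. 48–49
  (handles of index `1` on surfaces; Fig. 1.15–1.17), §2.3 (c), Thm. 3.1. [Matsumoto2001]
* J. Milnor, *Lectures on the h-cobordism theorem*, Princeton (1965), Def. 3.1, Thm. 3.4,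
  proof of Thm. 3.12 (PDF p. 18), Thm. 4.1 (PDF p. 22). [MilnorHCobordism1965]
* M. W. Hirsch, *Differential Topology*, GTM 33 (1976), Ch. 4 §4 (orientations), Ch. 9 §3.
  [HirschDT1976]
-/

open scoped Manifold ContDiff Topology
open Set Function Filter Metric Module

noncomputable section

namespace Literature.Topology.FourManifolds

open Flow MilnorBox

/-- Local notation: `𝔼 n` is the model Euclidean space `EuclideanSpace ℝ (Fin n)`. -/
local notation "𝔼 " n:arg => EuclideanSpace ℝ (Fin n)

/-! ### A topological lemma: closing up the image of an open arc by its end point limit -/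

/-- If `g` is continuous on `(a, b)` and tends to `d` at both ends, then `g((a, b)) ∪ {d}` is
closed (Hausdorff target). [folklore] -/
theorem isClosed_image_Ioo_union {α : Type*} [TopologicalSpace α] [T2Space α] {g : ℝ → α}
    {a b : ℝ} (hab : a < b) {d : α} (hcont : ContinuousOn g (Ioo a b))
    (ha : Tendsto g (𝓝[>] a) (𝓝 d)) (hb : Tendsto g (𝓝[<] b) (𝓝 d)) :
    IsClosed (g '' Ioo a b ∪ {d}) := by
  refine isClosed_of_closure_subset fun z hz => ?_
  by_contra hzK
  have hzd : z ≠ d := fun h => hzK (Or.inr h)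
  have hzim : z ∉ g '' Ioo a b := fun h => hzK (Or.inl h)
  -- separate `z` and `d`
  obtain ⟨U, V, hU, hV, hzU, hdV, hUV⟩ := t2_separation hzd
  -- near the two ends `g` stays in `V`
  obtain ⟨τ₁, hτ₁, h₁⟩ : ∃ τ > 0, ∀ t ∈ Ioo a (a + τ), g t ∈ V := by
    have := ha (hV.mem_nhds hdV)
    obtain ⟨u, hu, hsub⟩ := mem_nhdsGT_iff_exists_Ioo_subset.1 this
    have hu' : a < u := hu
    exact ⟨u - a, by linarith, fun t ht => hsub ⟨ht.1, by linarith [ht.2]⟩⟩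
  obtain ⟨τ₂, hτ₂, h₂⟩ : ∃ τ > 0, ∀ t ∈ Ioo (b - τ) b, g t ∈ V := by
    have := hb (hV.mem_nhds hdV)
    obtain ⟨l, hl, hsub⟩ := mem_nhdsLT_iff_exists_Ioo_subset.1 this
    have hl' : l < b := hl
    exact ⟨b - l, by linarith, fun t ht => hsub ⟨by linarith [ht.1], ht.2⟩⟩
  -- shrink so that the end pieces lie inside `(a, b)`
  set τ := min (min τ₁ τ₂) ((b - a) / 2) with hτ
  have hτpos : 0 < τ := by positivity
  have hτ1 : τ ≤ τ₁ := (min_le_left _ _).trans (min_le_left _ _)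
  have hτ2 : τ ≤ τ₂ := (min_le_left _ _).trans (min_le_right _ _)
  have hτab : τ ≤ (b - a) / 2 := min_le_right _ _
  -- decomposition of the image
  have hdecomp : g '' Ioo a b ⊆ V ∪ g '' Icc (a + τ / 2) (b - τ / 2) := by
    rintro _ ⟨t, ht, rfl⟩
    by_cases h1 : t < a + τ
    · exact Or.inl (h₁ t ⟨ht.1, by linarith⟩)
    by_cases h2 : b - τ < t
    · exact Or.inl (h₂ t ⟨by linarith, ht.2⟩)
    push Not at h1 h2
    exact Or.inr ⟨t, ⟨by linarith, by linarith⟩, rfl⟩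
  have hcpt : IsCompact (g '' Icc (a + τ / 2) (b - τ / 2)) :=
    (isCompact_Icc.image_of_continuousOn (hcont.mono fun t ht => ⟨by linarith [ht.1], by linarith [ht.2]⟩))
  have hclosed : IsClosed (Uᶜ ∪ g '' Icc (a + τ / 2) (b - τ / 2)) :=
    hU.isClosed_compl.union hcpt.isClosed
  have hsub : g '' Ioo a b ⊆ Uᶜ ∪ g '' Icc (a + τ / 2) (b - τ / 2) := fun w hw => by
    rcases hdecomp hw with h | h
    · exact Or.inl fun hwU => Set.disjoint_left.1 hUV hwU h
    · exact Or.inr h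
  rw [closure_union, closure_singleton] at hz
  rcases hz with hz | hz
  · have hz' := (closure_minimal hsub hclosed) hz
    rcases hz' with h | h
    · exact h hzU
    · exact hzim (image_mono (Icc_subset_Ioo (by linarith) (by linarith)) h)
  · exact hzd hz

/-! ### The saddle box is preconnected -/

section Box

variable {M : Type*} [TopologicalSpace M] [ChartedSpace (𝔼 2) M]
  {f : M → ℝ} {ξ : Π x : M, TangentSpace (𝓡 2) x} {q : M}

/-- The saddle box is the image of the convex model box under the inverse chart, hence
preconnected. [cite: MilnorHCobordism1965, proof of Thm. 3.13] -/
theorem MilnorBox.isPreconnected_box (D : MilnorBox (𝓡 2) f ξ q) (hk : D.k = 1) :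
    IsPreconnected D.box := by
  set Ω : Set (𝔼 2) := {v | v 0 ^ 2 < D.ε ^ 2 ∧ v 1 ^ 2 < 4 * D.ε ^ 2} with hΩ
  have hε := D.eps_pos
  -- `Ω` is an intersection of four half-planes
  have hΩeq : Ω = ({v : 𝔼 2 | v 0 < D.ε} ∩ {v | -D.ε < v 0}) ∩ ({v | v 1 < 2 * D.ε} ∩ {v | -(2 * D.ε) < v 1}) := by
    ext v
    simp only [hΩ, mem_setOf_eq, mem_inter_iff]
    constructor
    · rintro ⟨h0, h1⟩
      have h0' : |v 0| < D.ε := abs_lt_of_sq_lt_sq (by simpa using h0) hε.le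
      have h1' : |v 1| < 2 * D.ε := abs_lt_of_sq_lt_sq (by nlinarith [h1]) (by linarith)
      exact ⟨⟨(abs_lt.1 h0').2, (abs_lt.1 h0').1⟩, ⟨(abs_lt.1 h1').2, (abs_lt.1 h1').1⟩⟩
    · rintro ⟨⟨h0, h0'⟩, ⟨h1, h1'⟩⟩
      have ha : |v 0| < D.ε := abs_lt.2 ⟨h0', h0⟩
      have hb : |v 1| < 2 * D.ε := abs_lt.2 ⟨h1', h1⟩
      refine ⟨?_, ?_⟩
      · have := sq_lt_sq' (abs_lt.1 ha).1 (abs_lt.1 ha).2; simpa using this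
      · have := sq_lt_sq' (abs_lt.1 hb).1 (abs_lt.1 hb).2; nlinarith [this, abs_nonneg (v 1)]
  have hlin : ∀ i : Fin 2, IsLinearMap ℝ fun v : 𝔼 2 => v i := fun i =>
    (EuclideanSpace.proj (𝕜 := ℝ) i).toLinearMap.isLinear
  have hΩconv : Convex ℝ Ω := by
    rw [hΩeq]
    exact ((convex_halfSpace_lt (hlin 0) _).inter (convex_halfSpace_gt (hlin 0) _)).inter
      ((convex_halfSpace_lt (hlin 1) _).inter (convex_halfSpace_gt (hlin 1) _))
  -- `box = pt '' Ω`
  have hΩsub : Ω ⊆ {v | sqSumLT D.k v ≤ D.ε ^ 2 ∧ sqSumGE D.k v ≤ 4 * D.ε ^ 2} := fun v hv => by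
    show sqSumLT D.k v ≤ D.ε ^ 2 ∧ sqSumGE D.k v ≤ 4 * D.ε ^ 2
    rw [hk, sqSumLT_one_two, sqSumGE_one_two]; exact ⟨hv.1.le, hv.2.le⟩
  have hbox : D.box = D.pt '' Ω := by
    ext z
    constructor
    · intro hz
      obtain ⟨hsrc, hx, hy⟩ := (mem_box_iff hk).1 hz
      exact ⟨D.coord z, ⟨hx, hy⟩, D.pt_coord hsrc⟩
    · rintro ⟨v, hv, rfl⟩
      have h := hΩsub hv
      rw [mem_box_iff hk]
      refine ⟨D.pt_mem_source h.1 h.2, ?_, ?_⟩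
      · unfold MilnorBox.xc; rw [D.coord_pt h.1 h.2]; exact hv.1
      · unfold MilnorBox.yc; rw [D.coord_pt h.1 h.2]; exact hv.2
  rw [hbox]
  exact hΩconv.isPreconnected.image _ (D.continuousOn_pt.mono hΩsub)

end Box

/-! ### The orientation argument and the splitting -/

section Split

variable {M : Type*} [TopologicalSpace M] [ChartedSpace (𝔼 2) M] [IsManifold (𝓡 2) ∞ M]
  [T2Space M] [CompactSpace M]
  {f : M → ℝ} {ξ : Π x : M, TangentSpace (𝓡 2) x}

namespace LowestSaddle

variable (S : LowestSaddle f ξ)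

/-! #### Determinants of axis-aligned frames of `ℝ²` -/

/-- The reference constant `det_b((1,0),(0,1))` of the plane (nonzero, sign unspecified: `b`
is the abstract reference basis `Module.finBasis`). [folklore] -/
def K₀ : ℝ := (finBasis ℝ (𝔼 2)).det (frame₂ (!₂[1, 0] : 𝔼 2) (!₂[0, 1]))

omit [IsManifold (𝓡 2) ∞ M] [T2Space M] [CompactSpace M] in
/-- `K₀ ≠ 0`: `(1,0), (0,1)` is a basis. [folklore] -/
theorem K₀_ne_zero : K₀ ≠ 0 := by
  refine det_frame₂_ne_zero_of_linearIndependent (by simp) ?_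
  rw [LinearIndependent.pair_iff]
  intro s t h
  have h0 := congrArg (fun v : 𝔼 2 => v 0) h
  have h1 := congrArg (fun v : 𝔼 2 => v 1) h
  simp at h0 h1
  exact ⟨h0, h1⟩

omit [IsManifold (𝓡 2) ∞ M] [T2Space M] [CompactSpace M] in
/-- **Determinant of an axis-aligned frame**: `det_b((c,0),(0,d)) = c d K₀` (multilinearity). [folklore] -/
theorem det_frame₂_axes (c d : ℝ) :
    (finBasis ℝ (𝔼 2)).det (frame₂ (!₂[c, 0] : 𝔼 2) (!₂[0, d])) = c * d * K₀ := by
  classical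
  set i₀ : Fin (finrank ℝ (𝔼 2)) := ⟨0, by simp⟩ with hi₀
  set i₁ : Fin (finrank ℝ (𝔼 2)) := ⟨1, by simp⟩ with hi₁
  have hval : ∀ i : Fin (finrank ℝ (𝔼 2)), i = i₀ ∨ i = i₁ := fun i => by
    have hi : (i : ℕ) < 2 := by have := i.2; simpa using this
    rcases Nat.lt_succ_iff.1 hi |>.eq_or_lt with h | h
    · right; exact Fin.ext (by simpa [hi₁] using h)
    · left; exact Fin.ext (by simp [hi₀]; omega)
  -- scaling the first vector
  have hupd₀ : ∀ (u v : 𝔼 2) (r : ℝ), frame₂ (r • u) v = Function.update (frame₂ u v) i₀ (r • u) := by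
    intro u v r; funext i
    rcases hval i with h | h
    · subst h; rw [Function.update_self, frame₂_apply_of_eq_zero _ _ (by simp [hi₀])]
    · subst h
      rw [Function.update_of_ne (by simp [hi₀, hi₁, Fin.ext_iff]),
        frame₂_apply_of_ne_zero _ _ (by simp [hi₁]), frame₂_apply_of_ne_zero _ _ (by simp [hi₁])]
  have hupd₁ : ∀ (u v : 𝔼 2) (r : ℝ), frame₂ u (r • v) = Function.update (frame₂ u v) i₁ (r • v) := by
    intro u v r; funext i
    rcases hval i with h | h
    · subst h
      rw [Function.update_of_ne (by simp [hi₀, hi₁, Fin.ext_iff]),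
        frame₂_apply_of_eq_zero _ _ (by simp [hi₀]), frame₂_apply_of_eq_zero _ _ (by simp [hi₀])]
    · subst h; rw [Function.update_self, frame₂_apply_of_ne_zero _ _ (by simp [hi₁])]
  have hsmul₀ : ∀ (u v : 𝔼 2) (r : ℝ),
      (finBasis ℝ (𝔼 2)).det (frame₂ (r • u) v) = r * (finBasis ℝ (𝔼 2)).det (frame₂ u v) := by
    intro u v r
    rw [hupd₀, AlternatingMap.map_update_smul, smul_eq_mul]
    congr 2
    funext i
    rcases hval i with h | h
    · subst h; rw [Function.update_self, frame₂_apply_of_eq_zero _ _ (by simp [hi₀])]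
    · subst h; rw [Function.update_of_ne (by simp [hi₀, hi₁, Fin.ext_iff])]
  have hsmul₁ : ∀ (u v : 𝔼 2) (r : ℝ),
      (finBasis ℝ (𝔼 2)).det (frame₂ u (r • v)) = r * (finBasis ℝ (𝔼 2)).det (frame₂ u v) := by
    intro u v r
    rw [hupd₁, AlternatingMap.map_update_smul, smul_eq_mul]
    congr 2
    funext i
    rcases hval i with h | h
    · subst h; rw [Function.update_of_ne (by simp [hi₀, hi₁, Fin.ext_iff])]
    · subst h; rw [Function.update_self, frame₂_apply_of_ne_zero _ _ (by simp [hi₁])]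
  have hc : (!₂[c, 0] : 𝔼 2) = c • !₂[1, 0] := by ext i; fin_cases i <;> simp
  have hd : (!₂[0, d] : 𝔼 2) = d • !₂[0, 1] := by ext i; fin_cases i <;> simp
  rw [hc, hd, hsmul₀, hsmul₁, K₀]; ring

/-! #### The orientation forces opposite vertical velocities at `e₊` and `e₋` -/

/-- **The untwisted handle.**  If `M` carries a smooth orientation, the vertical chart
velocities `b₊`, `b₋` of the level curve at `e₊ = φ⁻¹(√κ, 0)` and `e₋ = φ⁻¹(-√κ, 0)` have
opposite signs: the orientation character of the frame `(ξ, ḣ)` is the same at the two points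
(constant along the curve), the chart has the same character at both (connected box), so the
chart determinants `-√κ b₊ K₀` and `√κ b₋ K₀` have the same sign (Hirsch 1976, Ch. 4 §4;
Matsumoto 2001, §1.5(b): on an orientable surface a `1`-handle is attached preserving the
orientations of both feet). [cite: HirschDT1976, Ch. 4 §4] [cite: Matsumoto2001, §1.5(b) (PDF pp. 48–49), Fig. 1.15–1.17] -/
theorem chartVel_mul_chartVel_neg (o : SmoothOrientation (𝓡 2) M) {θp θm : ℝ}
    (hp : S.levelCurve θp = S.Dsad.ePt S.sqκ) (hm : S.levelCurve θm = S.Dsad.ePt (-S.sqκ)) :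
    S.chartVel θp 1 * S.chartVel θm 1 < 0 := by
  have hκp : S.sqκ ^ 2 = S.κ := S.sqκ_sq
  have hκm : (-S.sqκ) ^ 2 = S.κ := by rw [neg_sq]; exact S.sqκ_sq
  -- constancy of the orientation character along the level curve
  have hconst := o.isPosFrame_frame₂_iff_of_isPreconnected (c := S.levelCurve)
    (S.contMDiff_levelCurve.of_le (by norm_num)) (V := ξ) S.contMDiff.continuous
    isPreconnected_univ (fun t _ => S.det_frame_ne_zero t) (mem_univ θp) (mem_univ θm)
  -- compare through the saddle chart on its (preconnected) box
  have hboxp : S.levelCurve θp ∈ S.Dsad.box := by rw [hp]; exact (S.ePt_props hκp).1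
  have hboxm : S.levelCurve θm ∈ S.Dsad.box := by rw [hm]; exact (S.ePt_props hκm).1
  have hreadp := S.readFrame_ePt hκp hp
  have hreadm := S.readFrame_ePt hκm hm
  rw [neg_neg] at hreadm
  set bp := S.chartVel θp 1 with hbp
  set bm := S.chartVel θm 1 with hbm
  have hbp0 : bp ≠ 0 := (S.chartVel_ePt hκp hp).2.1
  have hbm0 : bm ≠ 0 := (S.chartVel_ePt hκm hm).2.1
  have hdetp : (finBasis ℝ (𝔼 2)).det
      (readFrame S.Dsad.chart (S.levelCurve θp) (frame₂ (ξ (S.levelCurve θp)) (S.levelVel θp))) =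
        -S.sqκ * bp * K₀ := by rw [hreadp, det_frame₂_axes]
  have hdetm : (finBasis ℝ (𝔼 2)).det
      (readFrame S.Dsad.chart (S.levelCurve θm) (frame₂ (ξ (S.levelCurve θm)) (S.levelVel θm))) =
        S.sqκ * bm * K₀ := by rw [hreadm, det_frame₂_axes]
  have hK := K₀_ne_zero
  have hsq := S.sqκ_pos
  have hvp : -S.sqκ * bp * K₀ ≠ 0 := by
    refine mul_ne_zero (mul_ne_zero ?_ hbp0) hK; linarith
  have hvm : S.sqκ * bm * K₀ ≠ 0 := mul_ne_zero (mul_ne_zero hsq.ne' hbm0) hK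
  have hcmp := o.isPosFrame_iff_isPosFrame_iff_det_readFrame S.Dsad.mem_maximalAtlas
    (S.Dsad.isPreconnected_box S.ksad) (fun z hz => hz.1) hboxp hboxm
    (v := frame₂ (ξ (S.levelCurve θp)) (S.levelVel θp))
    (v' := frame₂ (ξ (S.levelCurve θm)) (S.levelVel θm))
    (by rw [hdetp]; exact hvp) (by rw [hdetm]; exact hvm)
  rw [hdetp, hdetm] at hcmp
  have hsame : 0 < (-S.sqκ * bp * K₀) * (S.sqκ * bm * K₀) :=
    (mul_pos_iff_pos_iff_pos hvp hvm).2 (hcmp.1 hconst)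
  have hpos : 0 < S.sqκ ^ 2 * K₀ ^ 2 := by positivity
  have : (-S.sqκ * bp * K₀) * (S.sqκ * bm * K₀) = -(S.sqκ ^ 2 * K₀ ^ 2) * (bp * bm) := by ring
  rw [this] at hsame
  nlinarith

/-! #### One-sided behaviour of the level curve at `e±`, and the projection to the upper level -/

/-- The sign of a nonzero real, as `±1`. [folklore] -/
def sgn (b : ℝ) : ℝ := if 0 < b then 1 else -1

omit [IsManifold (𝓡 2) ∞ M] [T2Space M] [CompactSpace M] in
/-- `sgn b = ±1`. [folklore] -/
theorem sgn_eq_or (b : ℝ) : sgn b = 1 ∨ sgn b = -1 := by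
  unfold sgn; split_ifs <;> simp

omit [IsManifold (𝓡 2) ∞ M] [T2Space M] [CompactSpace M] in
/-- `0 < b y → 0 < sgn b · y`. [folklore] -/
theorem sgn_mul_pos {b y : ℝ} (h : 0 < b * y) : 0 < sgn b * y := by
  unfold sgn; split_ifs with hb
  · rw [one_mul]; exact pos_of_mul_pos_right h hb.le
  · push Not at hb
    have hb' : b < 0 := lt_of_le_of_ne hb fun h0 => by rw [h0, zero_mul] at h; exact lt_irrefl _ h
    have : y < 0 := by nlinarith
    linarith

omit [IsManifold (𝓡 2) ∞ M] [T2Space M] [CompactSpace M] in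
/-- `b y < 0 → 0 < -sgn b · y`. [folklore] -/
theorem neg_sgn_mul_pos {b y : ℝ} (h : b * y < 0) : 0 < -sgn b * y := by
  unfold sgn; split_ifs with hb
  · have : y < 0 := by nlinarith
    linarith
  · push Not at hb
    have hb' : b < 0 := lt_of_le_of_ne hb fun h0 => by rw [h0, zero_mul] at h; exact lt_irrefl _ h
    have : 0 < y := by nlinarith
    linarith

omit [IsManifold (𝓡 2) ∞ M] [T2Space M] [CompactSpace M] in
/-- Reals of opposite signs have opposite `sgn`. [folklore] -/
theorem sgn_eq_neg_sgn_of_mul_neg {b b' : ℝ} (h : b * b' < 0) : sgn b' = -sgn b := by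
  unfold sgn; split_ifs with h1 h2 h2
  · nlinarith
  · norm_num
  · norm_num
  · push Not at h1 h2; nlinarith

/-- **Sides of the stable manifold crossed by the level curve at `e±`.**  If `h θ₀ = e± =
φ⁻¹(a, 0)` and `b = dφ(ḣ θ₀)₁ ≠ 0`, then just after `θ₀` the curve is on the side
`sign y = sign b` and just before on the side `sign y = -sign b` (first-order expansion of
`y ∘ h`, through the slope of `coord ∘ h`). [folklore] -/
theorem eventually_sign_yc {θ₀ a : ℝ} (ha : a ^ 2 = S.κ) (hθ : S.levelCurve θ₀ = S.Dsad.ePt a) :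
    (∀ᶠ θ in 𝓝[>] θ₀, 0 < sgn (S.chartVel θ₀ 1) * S.Dsad.yc (S.levelCurve θ)) ∧
      (∀ᶠ θ in 𝓝[<] θ₀, 0 < -sgn (S.chartVel θ₀ 1) * S.Dsad.yc (S.levelCurve θ)) := by
  obtain ⟨hbox, hx, hy, -, -⟩ := S.ePt_props ha
  have hz : S.levelCurve θ₀ ∈ S.Dsad.chart.source := by rw [hθ]; exact hbox.1
  obtain ⟨-, hb0, heq⟩ := S.chartVel_ePt ha hθ
  set b := S.chartVel θ₀ 1 with hb
  -- slope of `coord ∘ h` tends to `(0, b)`; take the second coordinate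
  have hd := S.hasDerivAt_coord_levelCurve hz
  rw [hasDerivAt_iff_tendsto_slope] at hd
  have h1 : Tendsto (fun θ => (slope (fun θ' => S.Dsad.coord (S.levelCurve θ')) θ₀ θ) 1)
      (𝓝[≠] θ₀) (𝓝 (S.chartVel θ₀ 1)) :=
    ((EuclideanSpace.proj (𝕜 := ℝ) (1 : Fin 2)).continuous.tendsto _).comp hd
  have h2 : Tendsto (fun θ => (θ - θ₀)⁻¹ * S.Dsad.yc (S.levelCurve θ)) (𝓝[≠] θ₀) (𝓝 b) := by
    refine h1.congr fun θ => ?_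
    rw [slope_def_module]
    have h0 : S.Dsad.coord (S.levelCurve θ₀) 1 = 0 := by rw [hθ]; exact hy
    simp only [PiLp.smul_apply, PiLp.sub_apply, smul_eq_mul, h0, sub_zero]
    rfl
  have h3 : Tendsto (fun θ => (θ - θ₀)⁻¹ * S.Dsad.yc (S.levelCurve θ) * b) (𝓝[≠] θ₀) (𝓝 (b * b)) :=
    h2.mul_const b
  have hbb : 0 < b * b := mul_self_pos.2 hb0
  have hev : ∀ᶠ θ in 𝓝[≠] θ₀, 0 < (θ - θ₀)⁻¹ * S.Dsad.yc (S.levelCurve θ) * b :=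
    h3.eventually (eventually_gt_nhds hbb)
  constructor
  · have hev' : ∀ᶠ θ in 𝓝[>] θ₀, 0 < (θ - θ₀)⁻¹ * S.Dsad.yc (S.levelCurve θ) * b :=
      hev.filter_mono (nhdsWithin_mono _ fun θ hθ => ne_of_gt hθ)
    filter_upwards [hev', self_mem_nhdsWithin] with θ hθ hθ'
    have hpos : 0 < (θ - θ₀)⁻¹ := inv_pos.2 (sub_pos.2 hθ')
    apply sgn_mul_pos
    have : 0 < S.Dsad.yc (S.levelCurve θ) * b := by
      rw [mul_assoc] at hθ; exact (mul_pos_iff_of_pos_left hpos).1 hθ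
    rw [mul_comm]; exact this
  · have hev' : ∀ᶠ θ in 𝓝[<] θ₀, 0 < (θ - θ₀)⁻¹ * S.Dsad.yc (S.levelCurve θ) * b :=
      hev.filter_mono (nhdsWithin_mono _ fun θ hθ => ne_of_lt hθ)
    filter_upwards [hev', self_mem_nhdsWithin] with θ hθ hθ'
    have hneg : (θ - θ₀)⁻¹ < 0 := inv_lt_zero.2 (sub_neg.2 hθ')
    apply neg_sgn_mul_pos
    have : S.Dsad.yc (S.levelCurve θ) * b < 0 := by
      rw [mul_assoc] at hθ
      exact ((mul_pos_iff.1 hθ).resolve_left fun h => absurd h.1 (not_lt.2 hneg.le)).2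
    rw [mul_comm]; exact this

/-- The projection along the flow onto the upper level `hi = f(sad) + δ`. [cite: MilnorHCobordism1965, Thm. 4.1 (PDF p. 22)] -/
def proj (z : M) : M := levelProj S.contMDiff f S.hi z

/-- The hitting time onto the upper level. [cite: MilnorHCobordism1965, proof of Thm. 5.4, Assertion 4 (PDF p. 29)] -/
def projTime (z : M) : ℝ := hittingTime (flowθ S.contMDiff) f S.hi z

/-- Unfolding of `proj`. [folklore] -/
theorem proj_eq (z : M) : S.proj z = flow S.contMDiff z (S.projTime z) := rfl

omit [T2Space M] [CompactSpace M] in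
/-- `hi = f sad + δ`. [folklore] -/
theorem hi_eq : S.hi = f S.sad + S.δ := rfl

omit [T2Space M] [CompactSpace M] in
/-- `δ < 3ε²`. [folklore] -/
theorem δ_lt_three : S.δ < 3 * S.Dsad.ε ^ 2 := by
  have := S.δ_lt; nlinarith [S.Dsad.eps_pos]

/-- A point of the saddle box on the lower level, off the stable disc, hits the upper level at
a nonnegative time. [cite: MilnorHCobordism1965, proof of Thm. 3.12 (PDF p. 18)] -/
theorem projTime_nonneg_and {z : M} (hz : z ∈ S.Dsad.box) (hyc : S.Dsad.yc z ≠ 0) (hfz : f z ≤ S.hi) :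
    0 ≤ S.projTime z ∧ f (flow S.contMDiff z (S.projTime z)) = f S.sad + S.δ := by
  obtain ⟨τ, hτ0, hfτ, -⟩ := exists_flow_apply_eq_of_mem_box S.isMorse S.contMDiff S.ksad hz hyc
    (δ := S.δ) hfz S.δ_lt_three
  have huniq : S.projTime z = τ :=
    (isSmoothFlow_flow S.contMDiff).hittingTime_unique
      (S.isMorse.contMDiff.mdifferentiable (by simp))
      (S.isGradientLike.mlineDeriv_pos_of_level fun _ hx => S.not_isMCriticalPt_of_hi hx) hfτ
  rw [show S.projTime z = τ from huniq]
  exact ⟨hτ0, hfτ⟩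

/-- **Projection near `e±`**: along any filter finer than `𝓝 θ₀` (`h θ₀ = e±`) on which the
curve stays on the side `sign y = s` (`s = ±1`), the projected points tend to
`d_s = φ⁻¹(0, s√δ)`. [cite: MilnorHCobordism1965, proof of Thm. 4.1 (PDF p. 22: "when q lies near K, then π(q) lies near K")] -/
theorem tendsto_proj_levelCurve {θ₀ a : ℝ} (ha : a ^ 2 = S.κ) (hθ : S.levelCurve θ₀ = S.Dsad.ePt a)
    {F : Filter ℝ} (hF : F ≤ 𝓝 θ₀) {s : ℝ} (hs : s = 1 ∨ s = -1)
    (hsign : ∀ᶠ θ in F, 0 < s * S.Dsad.yc (S.levelCurve θ)) :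
    Tendsto (fun θ => S.proj (S.levelCurve θ)) F (𝓝 (S.Dsad.dPt (s * Real.sqrt S.δ))) := by
  obtain ⟨hbox, hx, hy, -, -⟩ := S.ePt_props ha
  have ha0 : a ≠ 0 := fun h => by rw [h] at ha; have := S.κ_pos; simp at ha; linarith
  have hcont : Tendsto S.levelCurve F (𝓝 (S.Dsad.ePt a)) :=
    (hθ ▸ S.continuous_levelCurve.continuousAt.tendsto).mono_left hF
  -- eventually in the box
  have hev_box : ∀ᶠ θ in F, S.levelCurve θ ∈ S.Dsad.box := hcont (S.Dsad.isOpen_box.mem_nhds hbox)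
  -- coordinates converge
  have hxc : Tendsto (fun θ => S.Dsad.xc (S.levelCurve θ)) F (𝓝 a) := by
    have hca : ContinuousAt S.Dsad.xc (S.Dsad.ePt a) :=
      S.Dsad.continuousOn_xc.continuousAt (S.Dsad.chart.open_source.mem_nhds hbox.1)
    have := hca.tendsto.comp hcont
    rwa [hx] at this
  have hyc : Tendsto (fun θ => S.Dsad.yc (S.levelCurve θ)) F (𝓝 0) := by
    have hca : ContinuousAt S.Dsad.yc (S.Dsad.ePt a) :=
      S.Dsad.continuousOn_yc.continuousAt (S.Dsad.chart.open_source.mem_nhds hbox.1)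
    have := hca.tendsto.comp hcont
    rwa [hy] at this
  have hev_x : ∀ᶠ θ in F, S.Dsad.xc (S.levelCurve θ) ≠ 0 :=
    hxc.eventually (isOpen_ne.mem_nhds ha0)
  have h0 : Tendsto (fun θ => S.Dsad.xc (S.levelCurve θ) * S.Dsad.yc (S.levelCurve θ)) F (𝓝 0) := by
    have := hxc.mul hyc; rwa [mul_zero] at this
  have hle : ∀ θ, f (S.levelCurve θ) ≤ S.hi := fun θ => by
    rw [S.apply_levelCurve]; have := S.lo_lt_sad; have := S.sad_lt_hi; linarith
  rcases hs with rfl | rfl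
  · rw [one_mul]
    refine tendsto_flow_pt_of_yc_pos S.isGradientLike S.isMorse S.contMDiff S.ksad
      (τ := fun θ => S.projTime (S.levelCurve θ)) S.δ_pos S.δ_lt_three ?_ h0
    filter_upwards [hev_box, hev_x, hsign] with θ hb hxθ hs
    rw [one_mul] at hs
    obtain ⟨hτ, hfτ⟩ := S.projTime_nonneg_and hb hs.ne' (hle θ)
    exact ⟨hb, hxθ, hs, hτ, hfτ⟩
  · rw [neg_one_mul]
    refine tendsto_flow_pt_of_yc_neg S.isGradientLike S.isMorse S.contMDiff S.ksad
      (τ := fun θ => S.projTime (S.levelCurve θ)) S.δ_pos S.δ_lt_three ?_ h0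
    filter_upwards [hev_box, hev_x, hsign] with θ hb hxθ hs
    have hs' : S.Dsad.yc (S.levelCurve θ) < 0 := by linarith
    obtain ⟨hτ, hfτ⟩ := S.projTime_nonneg_and hb hs'.ne (hle θ)
    exact ⟨hb, hxθ, hs', hτ, hfτ⟩

/-! #### Trajectories from the lower level to the upper level -/

/-- A point with value below the gap whose trajectory does not come from the saddle comes from
the minimum. [cite: Matsumoto2001, §2.3 (c) (PDF p. 74)] -/
theorem tendsto_atBot_pmin_of_not {x : M} (hx : f x < f S.sad + S.η)
    (hns : ¬ Tendsto (flow S.contMDiff x) atBot (𝓝 S.sad)) :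
    Tendsto (flow S.contMDiff x) atBot (𝓝 S.pmin) := by
  obtain ⟨r, hr, hrlim⟩ := S.isGradientLike.exists_isMCriticalPt_tendsto_flow_atBot S.isMorse S.contMDiff x
  have hmono := S.isGradientLike.monotone_comp_flow S.isMorse S.contMDiff x
  have hlimf : Tendsto (f ∘ flow S.contMDiff x) atBot (𝓝 (f r)) :=
    (S.isMorse.contMDiff.continuous.tendsto r).comp hrlim
  have hrx : f r ≤ f x := by simpa [flow_zero] using hmono.le_of_tendsto hlimf 0
  rcases S.crit_cases hr with h | h | h
  · rwa [h] at hrlim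
  · rw [h] at hrlim; exact absurd hrlim hns
  · linarith

/-- The points `d± = φ⁻¹(0, ±√δ)`, `b = ±√δ`: in the box, `x = 0`, `y = b`, on the upper level,
on the unstable set of the saddle. [cite: MilnorHCobordism1965, Def. 3.9 (PDF p. 16)] -/
theorem dPt_props {b : ℝ} (hb : b ^ 2 = S.δ) :
    S.Dsad.dPt b ∈ S.Dsad.box ∧ S.Dsad.xc (S.Dsad.dPt b) = 0 ∧ S.Dsad.yc (S.Dsad.dPt b) = b ∧
      f (S.Dsad.dPt b) = S.hi ∧ Tendsto (flow S.contMDiff (S.Dsad.dPt b)) atBot (𝓝 S.sad) := by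
  have hb2 : b ^ 2 < 4 * S.Dsad.ε ^ 2 := by rw [hb]; have := S.δ_lt; nlinarith [S.Dsad.eps_pos]
  obtain ⟨h1, h2, h3, h4, h5⟩ := pt_axis_y S.contMDiff S.ksad hb2
  exact ⟨h1, h2, h3, by rw [h4, hb]; rfl, h5⟩

omit [T2Space M] [CompactSpace M] in
/-- `(√δ)² = δ`. [folklore] -/
theorem sqrtδ_sq : (Real.sqrt S.δ) ^ 2 = S.δ := Real.sq_sqrt S.δ_pos.le

omit [T2Space M] [CompactSpace M] in
/-- `(±√δ)² = δ`. [folklore] -/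
theorem sq_eq_δ_of {s : ℝ} (hs : s = 1 ∨ s = -1) : (s * Real.sqrt S.δ) ^ 2 = S.δ := by
  rcases hs with rfl | rfl <;> simp [S.sqrtδ_sq]

/-- `d_s` does not reach the lower level: along its trajectory `f ≥ f(sad) > lo`. [folklore] -/
theorem not_hits_lo_dPt {b : ℝ} (hb : b ^ 2 = S.δ) : ¬ Hits (flowθ S.contMDiff) f S.lo (S.Dsad.dPt b) := by
  rintro ⟨t, ht⟩
  obtain ⟨-, -, -, -, hlim⟩ := S.dPt_props hb
  have hmono := S.isGradientLike.monotone_comp_flow S.isMorse S.contMDiff (S.Dsad.dPt b)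
  have hlimf : Tendsto (f ∘ flow S.contMDiff (S.Dsad.dPt b)) atBot (𝓝 (f S.sad)) :=
    (S.isMorse.contMDiff.continuous.tendsto _).comp hlim
  have h1 : f S.sad ≤ f (flow S.contMDiff (S.Dsad.dPt b) t) := hmono.le_of_tendsto hlimf t
  change f (flow S.contMDiff (S.Dsad.dPt b) t) = S.lo at ht
  have := S.lo_lt_sad; linarith

/-- `e_a` does not reach the upper level: along its trajectory `f ≤ f(sad) < hi`. [folklore] -/
theorem not_hits_hi_ePt {a : ℝ} (ha : a ^ 2 = S.κ) : ¬ Hits (flowθ S.contMDiff) f S.hi (S.Dsad.ePt a) := by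
  rintro ⟨t, ht⟩
  obtain ⟨-, -, -, -, hlim⟩ := S.ePt_props ha
  have hmono := S.isGradientLike.monotone_comp_flow S.isMorse S.contMDiff (S.Dsad.ePt a)
  have hlimf : Tendsto (f ∘ flow S.contMDiff (S.Dsad.ePt a)) atTop (𝓝 (f S.sad)) :=
    (S.isMorse.contMDiff.continuous.tendsto _).comp hlim
  have h1 : f (flow S.contMDiff (S.Dsad.ePt a) t) ≤ f S.sad := hmono.ge_of_tendsto hlimf t
  change f (flow S.contMDiff (S.Dsad.ePt a) t) = S.hi at ht
  have := S.sad_lt_hi; linarith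

/-- A point of the lower level other than `e±` reaches the upper level. [cite: MilnorHCobordism1965, Thm. 4.1 (PDF p. 22)] -/
theorem hits_hi_levelCurve {θ : ℝ} (hp : S.levelCurve θ ≠ S.Dsad.ePt S.sqκ)
    (hm : S.levelCurve θ ≠ S.Dsad.ePt (-S.sqκ)) : Hits (flowθ S.contMDiff) f S.hi (S.levelCurve θ) := by
  have hns : ¬ Tendsto (flow S.contMDiff (S.levelCurve θ)) atTop (𝓝 S.sad) := fun h => by
    rcases S.levelCurve_eq_ePt_or h with h' | h'
    · exact hp h'
    · exact hm h'
  obtain ⟨r, -, hr, hrlim⟩ := S.exists_tendsto_atTop_ge (le_of_eq (S.apply_levelCurve θ).symm) hns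
  obtain ⟨t, -, ht⟩ := exists_flow_eq_of_tendsto_atTop S.isMorse S.contMDiff hrlim
    (b := S.hi) (by rw [S.apply_levelCurve]; have := S.lo_lt_sad; have := S.sad_lt_hi; linarith)
    (lt_of_lt_of_le S.hi_lt_gap hr)
  exact ⟨t, ht⟩

/-- The projection is continuous at such points. [cite: MilnorHCobordism1965, proof of Thm. 5.4, Assertion 4 (PDF p. 29)] -/
theorem continuousAt_proj_levelCurve {θ : ℝ} (hp : S.levelCurve θ ≠ S.Dsad.ePt S.sqκ)
    (hm : S.levelCurve θ ≠ S.Dsad.ePt (-S.sqκ)) : ContinuousAt (fun θ => S.proj (S.levelCurve θ)) θ :=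
  ((S.isGradientLike.contMDiffAt_levelProj S.isMorse S.contMDiff
    (fun _ hx => S.not_isMCriticalPt_of_hi hx) (S.hits_hi_levelCurve hp hm)).continuousAt).comp
    S.continuous_levelCurve.continuousAt

/-- Distinct points of one period have distinct images under the level curve. [folklore] -/
theorem levelCurve_ne {θp θ θ' : ℝ} (hθ : θ ∈ Ico θp (θp + 2 * Real.pi))
    (hθ' : θ' ∈ Ico θp (θp + 2 * Real.pi)) (hne : θ ≠ θ') : S.levelCurve θ ≠ S.levelCurve θ' := by
  intro h
  rw [S.levelCurve_eq_levelCurve_iff] at h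
  obtain ⟨k, hk⟩ := Real.Angle.angle_eq_iff_two_pi_dvd_sub.1 h
  have hpi := Real.pi_pos
  have h1 : (k : ℝ) * (2 * Real.pi) < 1 * (2 * Real.pi) := by nlinarith [hθ.1, hθ.2, hθ'.1, hθ'.2]
  have h2 : (-1 : ℝ) * (2 * Real.pi) < k * (2 * Real.pi) := by nlinarith [hθ.1, hθ.2, hθ'.1, hθ'.2]
  have hk1 : (k : ℝ) < 1 := lt_of_mul_lt_mul_right h1 (by positivity)
  have hk2 : (-1 : ℝ) < k := lt_of_mul_lt_mul_right h2 (by positivity)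
  have hk0 : k = 0 := by
    have : (k : ℝ) < 1 := hk1; have : (-1 : ℝ) < k := hk2
    have hk1' : k < 1 := by exact_mod_cast hk1
    have hk2' : -1 < k := by exact_mod_cast hk2
    omega
  rw [hk0] at hk
  simp at hk
  exact hne (by linarith)

/-! #### The splitting -/

/-- **On an oriented closed surface the level above the lowest saddle is disconnected**: the
level `f⁻¹(f(sad) + δ)` is the disjoint union of two nonempty closed sets (the closures
`Ψ(h(θ₊, θ₋)) ∪ {d_σ}` and `Ψ(h(θ₋, θ₊ + 2π)) ∪ {d_{-σ}}` of the projections of the two arcs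
of the lower level circle, `σ` the common side of the stable manifold on which the first arc
begins and ends — the untwisted handle, `chartVel_mul_chartVel_neg`). [cite: Matsumoto2001, §1.5(b) (PDF pp. 48–49, handles of index 1 on surfaces)] [cite: HirschDT1976, Ch. 9 §3] -/
theorem exists_level_split (o : SmoothOrientation (𝓡 2) M) :
    ∃ K K' : Set M, IsClosed K ∧ IsClosed K' ∧ Disjoint K K' ∧ K ∪ K' = {y | f y = S.hi} ∧
      K.Nonempty ∧ K'.Nonempty := by
  have hκp : S.sqκ ^ 2 = S.κ := S.sqκ_sq
  have hκm : (-S.sqκ) ^ 2 = S.κ := by rw [neg_sq]; exact S.sqκ_sq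
  have hpi : 0 < 2 * Real.pi := by positivity
  -- the two angles, normalised to one period
  obtain ⟨θp, hθp⟩ := S.exists_levelCurve_eq_ePt hκp
  obtain ⟨θm₀, hθm₀⟩ := S.exists_levelCurve_eq_ePt hκm
  set θm := toIocMod hpi θp θm₀ with hθm_def
  have hθm : S.levelCurve θm = S.Dsad.ePt (-S.sqκ) := by
    rw [← hθm₀, S.levelCurve_eq_levelCurve_iff]
    refine Real.Angle.angle_eq_iff_two_pi_dvd_sub.2 ⟨-toIocDiv hpi θp θm₀, ?_⟩
    have := toIocMod_sub_self hpi θp θm₀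
    rw [hθm_def, this, zsmul_eq_mul]; push_cast; ring
  have hmem := toIocMod_mem_Ioc hpi θp θm₀
  rw [← hθm_def] at hmem
  have hepm : S.Dsad.ePt S.sqκ ≠ S.Dsad.ePt (-S.sqκ) := by
    intro h
    have := congrArg S.Dsad.xc h
    rw [(S.ePt_props hκp).2.1, (S.ePt_props hκm).2.1] at this
    have := S.sqκ_pos; linarith
  have hθm_lt : θm < θp + 2 * Real.pi := by
    rcases hmem.2.eq_or_lt with h | h
    · exfalso; apply hepm
      rw [← hθp, ← hθm, h, S.levelCurve_add_two_pi]
    · exact h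
  have hθpm : θp < θm := hmem.1
  -- the signs
  set bp := S.chartVel θp 1 with hbp
  set bm := S.chartVel θm 1 with hbm
  have hprod : bp * bm < 0 := S.chartVel_mul_chartVel_neg o hθp hθm
  set σ := sgn bp with hσ
  have hσm : sgn bm = -σ := sgn_eq_neg_sgn_of_mul_neg hprod
  have hσ1 : σ = 1 ∨ σ = -1 := sgn_eq_or bp
  have hσ1' : -σ = 1 ∨ -σ = -1 := by rcases hσ1 with h | h <;> simp [h]
  set d₁ := S.Dsad.dPt (σ * Real.sqrt S.δ) with hd₁
  set d₂ := S.Dsad.dPt (-σ * Real.sqrt S.δ) with hd₂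
  set g : ℝ → M := fun θ => S.proj (S.levelCurve θ) with hg
  -- one-sided limits
  obtain ⟨hp_right, hp_left⟩ := S.eventually_sign_yc hκp hθp
  obtain ⟨hm_right, hm_left⟩ := S.eventually_sign_yc hκm hθm
  rw [← hbp, ← hσ] at hp_right hp_left
  rw [← hbm, hσm] at hm_right hm_left
  rw [neg_neg] at hm_left
  have lim1a : Tendsto g (𝓝[>] θp) (𝓝 d₁) :=
    S.tendsto_proj_levelCurve hκp hθp nhdsWithin_le_nhds hσ1 hp_right
  have lim1b : Tendsto g (𝓝[<] θm) (𝓝 d₁) :=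
    S.tendsto_proj_levelCurve hκm hθm nhdsWithin_le_nhds hσ1 hm_left
  have lim2a : Tendsto g (𝓝[>] θm) (𝓝 d₂) :=
    S.tendsto_proj_levelCurve hκm hθm nhdsWithin_le_nhds hσ1' hm_right
  have lim2b' : Tendsto g (𝓝[<] θp) (𝓝 d₂) :=
    S.tendsto_proj_levelCurve hκp hθp nhdsWithin_le_nhds hσ1' hp_left
  have lim2b : Tendsto g (𝓝[<] (θp + 2 * Real.pi)) (𝓝 d₂) := by
    have hper : g = fun θ => g (θ - 2 * Real.pi) := by
      funext θ; simp only [hg]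
      rw [show S.levelCurve θ = S.levelCurve (θ - 2 * Real.pi) by
        conv_lhs => rw [show θ = θ - 2 * Real.pi + 2 * Real.pi by ring]
        exact S.levelCurve_add_two_pi _]
    have htr : Tendsto (fun θ => θ - 2 * Real.pi) (𝓝[<] (θp + 2 * Real.pi)) (𝓝[<] θp) := by
      have hc : ContinuousWithinAt (fun θ => θ - 2 * Real.pi) (Iio (θp + 2 * Real.pi)) (θp + 2 * Real.pi) :=
        (continuous_sub_right _).continuousWithinAt
      have := hc.tendsto_nhdsWithin (t := Iio θp) fun θ hθ => by
        show θ - 2 * Real.pi < θp; have : θ < θp + 2 * Real.pi := hθ; linarith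
      simpa using this
    rw [hper]
    exact lim2b'.comp htr
  -- continuity on the two arcs
  have harc : ∀ θ, θ ∈ Ioo θp θm ∪ Ioo θm (θp + 2 * Real.pi) →
      S.levelCurve θ ≠ S.Dsad.ePt S.sqκ ∧ S.levelCurve θ ≠ S.Dsad.ePt (-S.sqκ) := by
    intro θ hθ
    have hθI : θ ∈ Ico θp (θp + 2 * Real.pi) := by
      rcases hθ with h | h
      · exact ⟨h.1.le, by linarith [h.2]⟩
      · exact ⟨by linarith [h.1], h.2⟩
    have hpI : θp ∈ Ico θp (θp + 2 * Real.pi) := ⟨le_rfl, by linarith⟩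
    have hmI : θm ∈ Ico θp (θp + 2 * Real.pi) := ⟨hθpm.le, hθm_lt⟩
    have hne_p : θ ≠ θp := by rcases hθ with h | h <;> [exact ne_of_gt h.1; exact (by intro he; rw [he] at h; linarith [h.1])]
    have hne_m : θ ≠ θm := by rcases hθ with h | h <;> [exact ne_of_lt h.2; exact ne_of_gt h.1]
    exact ⟨hθp ▸ S.levelCurve_ne hθI hpI hne_p, hθm ▸ S.levelCurve_ne hθI hmI hne_m⟩
  have hcont1 : ContinuousOn g (Ioo θp θm) := fun θ hθ =>
    (S.continuousAt_proj_levelCurve (harc θ (Or.inl hθ)).1 (harc θ (Or.inl hθ)).2).continuousWithinAt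
  have hcont2 : ContinuousOn g (Ioo θm (θp + 2 * Real.pi)) := fun θ hθ =>
    (S.continuousAt_proj_levelCurve (harc θ (Or.inr hθ)).1 (harc θ (Or.inr hθ)).2).continuousWithinAt
  -- the two pieces
  set K := g '' Ioo θp θm ∪ {d₁} with hK
  set K' := g '' Ioo θm (θp + 2 * Real.pi) ∪ {d₂} with hK'
  have hKc : IsClosed K := isClosed_image_Ioo_union hθpm hcont1 lim1a lim1b
  have hK'c : IsClosed K' := isClosed_image_Ioo_union hθm_lt hcont2 lim2a lim2b
  -- facts about images
  have hD₁ := S.dPt_props (S.sq_eq_δ_of hσ1)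
  have hD₂ := S.dPt_props (S.sq_eq_δ_of hσ1')
  have hg_level : ∀ θ, θ ∈ Ioo θp θm ∪ Ioo θm (θp + 2 * Real.pi) → f (g θ) = S.hi := fun θ hθ =>
    apply_levelProj S.contMDiff (S.hits_hi_levelCurve (harc θ hθ).1 (harc θ hθ).2)
  have hg_hits_lo : ∀ θ, Hits (flowθ S.contMDiff) f S.lo (g θ) := fun θ =>
    (hits_levelProj_iff S.contMDiff).2 (hits_of_apply_eq (flow_zero S.contMDiff _) (S.apply_levelCurve θ))
  have hd_not_im : ∀ {s : ℝ}, (s = 1 ∨ s = -1) → ∀ θ, g θ ≠ S.Dsad.dPt (s * Real.sqrt S.δ) :=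
    fun hs θ h => S.not_hits_lo_dPt (S.sq_eq_δ_of hs) (h ▸ hg_hits_lo θ)
  refine ⟨K, K', hKc, hK'c, ?_, ?_, ⟨d₁, Or.inr rfl⟩, ⟨d₂, Or.inr rfl⟩⟩
  · -- disjointness
    rw [Set.disjoint_left]
    rintro z (⟨θ₁, hθ₁, rfl⟩ | rfl) hz'
    · rcases hz' with ⟨θ₂, hθ₂, heq⟩ | heq
      · -- `g` injective on the period
        have hinj : S.levelCurve θ₂ = S.levelCurve θ₁ :=
          S.isGradientLike.injOn_levelProj S.isMorse S.contMDiff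
            (fun _ hx => S.not_isMCriticalPt_of_lo hx) S.hi
            (S.apply_levelCurve θ₂) (S.apply_levelCurve θ₁) heq
        have hθ₁I : θ₁ ∈ Ico θp (θp + 2 * Real.pi) := ⟨hθ₁.1.le, by linarith [hθ₁.2]⟩
        have hθ₂I : θ₂ ∈ Ico θp (θp + 2 * Real.pi) := ⟨by linarith [hθ₂.1], hθ₂.2⟩
        exact S.levelCurve_ne hθ₂I hθ₁I (by intro h; rw [h] at hθ₂; linarith [hθ₁.2, hθ₂.1]) hinj
      · exact hd_not_im hσ1' θ₁ heq
    · rcases hz' with ⟨θ₂, -, heq⟩ | heq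
      · exact hd_not_im hσ1 θ₂ heq
      · -- `d₁ ≠ d₂`
        have h1 : S.Dsad.yc d₁ = σ * Real.sqrt S.δ := hD₁.2.2.1
        have h2 : S.Dsad.yc d₂ = -σ * Real.sqrt S.δ := hD₂.2.2.1
        have h3 : S.Dsad.yc d₁ = S.Dsad.yc d₂ := by rw [heq]
        rw [h1, h2] at h3
        have hsq : 0 < Real.sqrt S.δ := Real.sqrt_pos.2 S.δ_pos
        rcases hσ1 with h | h <;> · rw [h] at h3; linarith
  · -- cover
    apply Set.Subset.antisymm
    · rintro z (⟨⟨θ, hθ, rfl⟩ | rfl⟩ | ⟨⟨θ, hθ, rfl⟩ | rfl⟩)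
      · exact hg_level θ (Or.inl hθ)
      · exact hD₁.2.2.2.1
      · exact hg_level θ (Or.inr hθ)
      · exact hD₂.2.2.2.1
    · intro y hy
      change f y = S.hi at hy
      by_cases hyd₁ : y = d₁
      · exact Or.inl (Or.inr hyd₁)
      by_cases hyd₂ : y = d₂
      · exact Or.inr (Or.inr hyd₂)
      -- `y` comes from the minimum, hence from the lower level
      have hyc : ¬ IsMCriticalPt (𝓡 2) f y := S.not_isMCriticalPt_of_hi hy
      have hns : ¬ Tendsto (flow S.contMDiff y) atBot (𝓝 S.sad) := fun h => by
        rcases eq_dPt_or_of_tendsto_atBot S.isGradientLike S.isMorse S.contMDiff S.ksad S.δ_pos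
          (by have := S.δ_lt; nlinarith [S.Dsad.eps_pos]) hyc hy h with h' | h'
        · rcases hσ1 with hs | hs
          · exact hyd₁ (by rw [hd₁, hs, one_mul]; exact h')
          · exact hyd₂ (by rw [hd₂, hs, neg_neg, one_mul]; exact h')
        · rcases hσ1 with hs | hs
          · exact hyd₂ (by rw [hd₂, hs, neg_one_mul]; exact h')
          · exact hyd₁ (by rw [hd₁, hs, neg_one_mul]; exact h')
      have hlim := S.tendsto_atBot_pmin_of_not (by rw [hy]; exact S.hi_lt_gap) hns
      obtain ⟨t, -, ht⟩ := exists_flow_eq_of_tendsto_atBot S.isMorse S.contMDiff hlim (b := S.lo)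
        (by rw [hy]; have := S.lo_lt_sad; have := S.sad_lt_hi; linarith)
        (by have := S.min_lt_base; have := S.base_lt_lo; linarith)
      have hylo : Hits (flowθ S.contMDiff) f S.lo y := ⟨t, ht⟩
      set x := levelProj S.contMDiff f S.lo y with hx
      have hfx : f x = S.lo := apply_levelProj S.contMDiff hylo
      obtain ⟨θ₀, hθ₀⟩ := S.exists_levelCurve_eq hfx
      -- normalise the angle
      set θ := toIcoMod hpi θp θ₀ with hθ_def
      have hθeq : S.levelCurve θ = S.levelCurve θ₀ := by
        rw [S.levelCurve_eq_levelCurve_iff]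
        refine Real.Angle.angle_eq_iff_two_pi_dvd_sub.2 ⟨-toIcoDiv hpi θp θ₀, ?_⟩
        have := toIcoMod_sub_self hpi θp θ₀
        rw [hθ_def, this, zsmul_eq_mul]; push_cast; ring
      have hθI := toIcoMod_mem_Ico hpi θp θ₀
      rw [← hθ_def] at hθI
      have hxθ : S.levelCurve θ = x := hθeq.trans hθ₀
      -- `g θ = y`
      have hgθ : g θ = y := by
        show S.proj (S.levelCurve θ) = y
        rw [hxθ, hx]
        exact S.isGradientLike.levelProj_levelProj S.isMorse S.contMDiff
          (fun _ hx => S.not_isMCriticalPt_of_hi hx) hy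
      -- `x` is not `e±` (it reaches the upper level)
      have hxhi : Hits (flowθ S.contMDiff) f S.hi x :=
        (hits_levelProj_iff S.contMDiff).2 (hits_of_apply_eq (flow_zero S.contMDiff _) hy)
      have hθne_p : θ ≠ θp := fun h => S.not_hits_hi_ePt hκp (by rw [← hθp, ← h, hxθ]; exact hxhi)
      have hθne_m : θ ≠ θm := fun h => S.not_hits_hi_ePt hκm (by rw [← hθm, ← h, hxθ]; exact hxhi)
      rcases lt_or_gt_of_ne hθne_m with hlt | hgt
      · exact Or.inl (Or.inl ⟨θ, ⟨lt_of_le_of_ne hθI.1 (Ne.symm hθne_p), hlt⟩, hgθ⟩)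
      · exact Or.inr (Or.inl ⟨θ, ⟨hgt, hθI.2⟩, hgθ⟩)

/-- The width of a band about the upper level free of critical values. [folklore] -/
def ε₁ : ℝ := min S.δ (S.η - S.δ) / 2

omit [T2Space M] [CompactSpace M] in
/-- `0 < ε₁`. [folklore] -/
theorem ε₁_pos : 0 < S.ε₁ := by
  unfold ε₁; have := S.δ_pos; have := S.δ_lt_η
  have : 0 < min S.δ (S.η - S.δ) := lt_min (by linarith) (by linarith)
  linarith

omit [T2Space M] [CompactSpace M] in
/-- **No critical value in the band `[hi - ε₁, hi + ε₁]`.** [folklore] -/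
theorem not_mem_Icc_hi {q : M} (hq : IsMCriticalPt (𝓡 2) f q) : f q ∉ Icc (S.hi - S.ε₁) (S.hi + S.ε₁) := by
  intro h
  have hε : S.ε₁ ≤ S.δ / 2 ∧ S.ε₁ ≤ (S.η - S.δ) / 2 := by
    unfold ε₁
    exact ⟨by linarith [min_le_left S.δ (S.η - S.δ)], by linarith [min_le_right S.δ (S.η - S.δ)]⟩
  have hhi := S.hi_eq
  have := S.δ_lt_η
  rw [hhi] at h
  rcases S.crit_cases hq with h' | h' | h'
  · rw [h'] at h
    have := S.min_lt_base; have := S.base_lt_lo; have := S.lo_lt_sad; have := S.δ_pos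
    linarith [h.1]
  · rw [h'] at h; have := S.δ_pos; linarith [h.1]
  · linarith [h.2]

end LowestSaddle

end Split

end Literature.Topology.FourManifolds
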